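import Summits.BirchSwinnertonDyer.BirchSwinnertonDyer.Theorems.ByReductionTypeAtTwoSupersingularFlatBlindHondaOfLayerOneRank
import Literature.NumberTheory.EllipticCurves.LocalPointsFiniteIndexLatticeHolds
import Literature.NumberTheory.EllipticCurves.LocalPointsFiniteIndexLatticeProofs
import HarnessLib

/-!
# Route `ByReductionTypeAtTwo` (rung K4), crux `SupersingularRankZeroAtTwo` (item stmt-BirchSwinnertonDyer-19097):
# **THE HONDA RUNG CDF±_H IS AN UNCONDITIONAL THEOREM** — the layer-one rank input is the tree's DISCHARGED Silverman VII.6.3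
# (`silvermanVII63_localLayerPoints_finiteIndex_zpLattice_holds`): `E(ℚ_{1,v})` contains a finite-index subgroup `≃+ ℤ₂²`.
# Seat `bsd-2adic-ss-1`, GEN 19, LEAD attack (L3), part 6 (sequel of p810801, p810939, p811031, p811115, p811294; line
# `Lines/odd_blind_package.lean` v2.6.1 18db34093d095bfe, slot 5, rung `OddBlindPackage.FlatBlindLocalTransversalityHondaOffZeroAtTwo` :898).

HONEST FRAMING (cell `bsd-2adic`): THEOREMS ONLY; no definition, no named fact, no `sorry`, no instance.  Nothing booked (D-0054); BSD is
not proved by any of this; the rung is NOT a registered stub (slot 5's local conjunct is CDF± WITHOUT the Honda hypothesis until a v2.7 reshape);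
what is proved is exactly the rung's body.  bears_on: K4 (item 19097).

* §1 ★ `independent_of_nondegeneratePair` — p811294's `independent_of_layerOneRank` with the surjection `E(K_1·K_v) ↠ ℤ₂²` weakened to a
  NON-DEGENERATE PAIR: functionals `p₀, p₁` and points `m_A, m_B` of the layer with `p₀(m_A) ≠ 0`, `p₁(m_A) = 0`, `p₀(m_B) = 0`, `p₁(m_B) ≠ 0`
  (same proof: `ev`-determinant `D ≠ 0`, unit-normalise, saturate, dual basis).
* §2 ★ `exists_nondegeneratePair_of_lattice` — a finite-index subgroup `H ≤ E(K_1·K_v)` with `H ≃+ ℤ₂²` gives such a pair (`x ↦ φ(m·x)`,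
  `m` the index; `m_A = φ⁻¹(e₀)`, `m_B = φ⁻¹(e₁)`).
* §3 ★★★ `flatBlindLocalTransversalityHondaOffZeroAtTwo` — over `ℚ`: the rung's body VERBATIM, UNCONDITIONALLY: Silverman VII.6.3 at layer `1`
  (`silvermanVII63_localLayerPoints_finiteIndex_zpLattice_holds` + its `rat` reading; rank `(localLayerSubgroupOfEmb κ ι 1).index = 2` by
  `index_localLayerSubgroupOfEmb_eq_pow_of_isTopGenerator`) ⟹ §2 ⟹ §1 = (IND₁) ⟹ (D₁) ⟹ (K₈) ⟹ CDF±_H (p811115, p811031, p810939).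
NET (GEN 19): **CDF±_H — local transversality of the ♭ condition at `ψ₂` for every HONDA system at two, `a₂ = ±2` — is a kernel theorem.**
What remains of slot 5's local conjunct CDF± as typed is only the gap between arbitrary (L)(TR)(Z)(SAT)-systems and Honda systems (v2.7).

References: [Sprung2012] Thm. 2.2, Lemma 2.3, Cor. 2.10, Def. 5.9, Def. 7.9, Open Problem 7.22; [SilvermanAEC2009] VII Prop. 6.3, IV Thm. 6.4 (b);
[Kobayashi2003] Prop. 8.12; tree `LocalPointsFiniteIndexLattice{,Proofs,Holds}.lean`, `Sprung2012/HondaLevelTwoRelationsProofs.lean`, p811294.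
-/

set_option autoImplicit false
set_option linter.dupNamespace false

noncomputable section

open scoped Classical NumberField

universe u

namespace Summit.BirchSwinnertonDyer.BirchSwinnertonDyer.Theorems

namespace OddBlindLocal

open NumberField IsDedekindDomain Literature.NumberTheory.EllipticCurves Literature.NumberTheory.GaloisRepresentations
  ZpExtension Literature.NumberTheory.EllipticCurves.Kobayashi2003 Literature.NumberTheory.EllipticCurves.Sprung2017
  Literature.NumberTheory.EllipticCurves.Sprung2012 Literature.NumberTheory.EllipticCurves.Rank1Residual
  Summit.BirchSwinnertonDyer.Rank1Residual.F1Sign2 Summit.BirchSwinnertonDyer.Rank1Residual.Supersingular.BlindLever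

section Generic

variable {K : Type u} [Field K] {κ : ZpExtension K 2}
variable {E : Type u} [Field E] [Algebra K E] {ι : AlgebraicClosure K →ₐ[K] AlgebraicClosure E}
variable {W : WeierstrassCurve K}

/-! ## §1 (IND₁) from a non-degenerate pair of functionals -/

/-- ★ **(IND₁) from a NON-DEGENERATE PAIR** (generic base): (NT), a Honda system at two with even `a`, `g` a local lift of the topological
generator, and functionals `p₀, p₁` on `E(K_1·K_v)` with points `m_A, m_B` such that `p₀(m_A) ≠ 0 = p₁(m_A)`, `p₀(m_B) = 0 ≠ p₁(m_B)` ⟹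
`c₋` and `g·c₁` are `𝔽₂`-independent in `E(K_∞·K_v)/2`.  (As `independent_of_layerOneRank`, p811294, with the surjection weakened.)
[cite: Sprung2012, Thm. 2.2, Lemma 2.3, Cor. 2.10 (pp. 1487–1489)] [cite: SilvermanAEC2009, VII Prop. 6.3] -/
theorem independent_of_nondegeneratePair
    (hnt : ∀ P ∈ localTowerPointsOfEmb κ ι W, 2 • P = 0 → P = 0)
    {a : ℤ} (hap : (2 : ℤ) ∣ a) {g : Field.absoluteGaloisGroup E} (hg : κ.IsTopGenerator (resGalOfEmb ι g))
    {cneg : localPoints W E} {c : ℕ → localPoints W E} (hH : IsHondaSystemAtTwo κ ι W a g cneg c)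
    (hπ : ∃ (p₀ p₁ : localLayerPointsOfEmb κ ι W 1 →+ ℤ_[2]) (mA mB : localLayerPointsOfEmb κ ι W 1),
      p₀ mA ≠ 0 ∧ p₁ mA = 0 ∧ p₀ mB = 0 ∧ p₁ mB ≠ 0) :
    ∀ (m₁ m₂ : ℤ) (y : localPoints W E), y ∈ localTowerPointsOfEmb κ ι W →
      2 • y = m₁ • cneg + m₂ • (g • c 1) → (2 : ℤ) ∣ m₁ ∧ (2 : ℤ) ∣ m₂ := by
  have hc1 : c 1 ∈ localLayerPointsOfEmb κ ι W 1 := hH.2.1 1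
  have hgc1 : g • c 1 ∈ localLayerPointsOfEmb κ ι W 1 := smul_mem_localLayerPointsOfEmb κ ι W 1 g hc1
  have hcneg : cneg ∈ localLayerPointsOfEmb κ ι W 1 := localLayerPointsOfEmb_mono κ ι W (Nat.zero_le 1) hH.1
  obtain ⟨p₀, p₁, mA, mB, hA0, hA1, hB0, hB1⟩ := hπ
  let p : Fin 2 → (localLayerPointsOfEmb κ ι W 1 →+ ℤ_[2]) := ![p₀, p₁]
  have hp0 : p 0 = p₀ := rfl
  have hp1 : p 1 = p₁ := rfl
  -- `ev` of the coordinates and the determinant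
  set α₀ := p 0 ⟨g • c 1, hgc1⟩ with hα₀
  set α₁ := p 1 ⟨g • c 1, hgc1⟩ with hα₁
  set β₀ := p 0 ⟨cneg, hcneg⟩ with hβ₀
  set β₁ := p 1 ⟨cneg, hcneg⟩ with hβ₁
  set D := α₀ * β₁ - α₁ * β₀ with hD
  -- the two combinations with `ev = (0, D)` and `(D, 0)`
  let qB : localLayerPointsOfEmb κ ι W 1 →+ ℤ_[2] := (AddMonoidHom.mulLeft α₀).comp (p 1) - (AddMonoidHom.mulLeft α₁).comp (p 0)
  let qA : localLayerPointsOfEmb κ ι W 1 →+ ℤ_[2] := (AddMonoidHom.mulLeft β₁).comp (p 0) - (AddMonoidHom.mulLeft β₀).comp (p 1)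
  have hqB : ∀ x, qB x = α₀ * p 1 x - α₁ * p 0 x := fun _ ↦ rfl
  have hqA : ∀ x, qA x = β₁ * p 0 x - β₀ * p 1 x := fun _ ↦ rfl
  have hqB1 : qB ⟨g • c 1, hgc1⟩ = 0 := by rw [hqB]; ring
  have hqB0 : qB ⟨cneg, hcneg⟩ = D := by rw [hD]; exact hqB _
  have hqA1 : qA ⟨g • c 1, hgc1⟩ = D := by rw [hqA, hD]; ring
  have hqA0 : qA ⟨cneg, hcneg⟩ = 0 := by rw [hqA]; ring
  -- `D ≠ 0`: else `qB = 0` and `qA = 0` force `α = β = 0`, then `p 0 = 0`, contradicting `p 0 mA = 1`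
  have hDne : D ≠ 0 := by
    intro hD0
    have hqB00 : qB = 0 := eq_zero_of_apply_eq_zero_of_apply_eq_zero hg hH qB hqB1 (by rw [hqB0, hD0])
    have hqA00 : qA = 0 := eq_zero_of_apply_eq_zero_of_apply_eq_zero hg hH qA (by rw [hqA1, hD0]) hqA0
    have e1 : α₀ = 0 := by
      have h : qB mB = 0 := by rw [hqB00, AddMonoidHom.zero_apply]
      rw [hqB, hp0, hp1, hB0, mul_zero, sub_zero] at h
      exact (mul_eq_zero.mp h).resolve_right hB1
    have e2 : α₁ = 0 := by
      have h : qB mA = 0 := by rw [hqB00, AddMonoidHom.zero_apply]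
      rw [hqB, hp0, hp1, hA1, mul_zero, zero_sub, neg_eq_zero] at h
      exact (mul_eq_zero.mp h).resolve_right hA0
    have e3 : β₀ = 0 := by
      have h : qA mB = 0 := by rw [hqA00, AddMonoidHom.zero_apply]
      rw [hqA, hp0, hp1, hB0, mul_zero, zero_sub, neg_eq_zero] at h
      exact (mul_eq_zero.mp h).resolve_right hB1
    have hp00 : p 0 = 0 := eq_zero_of_apply_eq_zero_of_apply_eq_zero hg hH (p 0) e1 e3
    have h : p₀ mA = 0 := by rw [← hp0, hp00, AddMonoidHom.zero_apply]
    exact hA0 h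
  -- `D = U · 2^e`
  have hDspec := PadicInt.unitCoeff_spec hDne
  set U : ℤ_[2]ˣ := PadicInt.unitCoeff hDne
  set e : ℕ := D.valuation
  have h2e : ((2 : ℕ) : ℤ_[2]) ^ e = (2 : ℤ_[2]) ^ e := by norm_num
  -- unit-normalise and saturate: the dual basis
  have hcompB : ∀ x, ((AddMonoidHom.mulLeft ((U⁻¹ : ℤ_[2]ˣ) : ℤ_[2])).comp qB) x = ((U⁻¹ : ℤ_[2]ˣ) : ℤ_[2]) * qB x :=
    fun _ ↦ rfl
  have hcompA : ∀ x, ((AddMonoidHom.mulLeft ((U⁻¹ : ℤ_[2]ˣ) : ℤ_[2])).comp qA) x = ((U⁻¹ : ℤ_[2]ˣ) : ℤ_[2]) * qA x :=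
    fun _ ↦ rfl
  obtain ⟨fB, hfB1, hfB0⟩ := exists_apply_eq_of_apply_eq_pow_mul hap hg hH e 0 1
    ⟨(AddMonoidHom.mulLeft ((U⁻¹ : ℤ_[2]ˣ) : ℤ_[2])).comp qB, by
      rw [hcompB, hqB1, mul_zero, mul_zero], by
      rw [hcompB, hqB0, hDspec, ← mul_assoc, Units.inv_mul, one_mul, h2e, mul_one]⟩
  obtain ⟨fA, hfA1, hfA0⟩ := exists_apply_eq_of_apply_eq_pow_mul hap hg hH e 1 0
    ⟨(AddMonoidHom.mulLeft ((U⁻¹ : ℤ_[2]ˣ) : ℤ_[2])).comp qA, by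
      rw [hcompA, hqA1, hDspec, ← mul_assoc, Units.inv_mul, one_mul, h2e, mul_one], by
      rw [hcompA, hqA0, mul_zero, mul_zero]⟩
  -- conclude
  intro m₁ m₂ y hy h2y
  have hyM : y ∈ localLayerPointsOfEmb κ ι W 1 := by
    refine mem_localLayerPointsOfEmb_of_pow_nsmul_mem κ ι W hnt hy (k := 1) ?_
    rw [pow_one, h2y]
    exact add_mem (AddSubgroup.zsmul_mem _ hcneg _) (AddSubgroup.zsmul_mem _ hgc1 _)
  have e : (2 • ⟨y, hyM⟩ : localLayerPointsOfEmb κ ι W 1) = m₁ • ⟨cneg, hcneg⟩ + m₂ • ⟨g • c 1, hgc1⟩ := Subtype.ext h2y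
  have hcast : ∀ m : ℤ, (2 : ℤ_[2]) ∣ (m : ℤ_[2]) → (2 : ℤ) ∣ m := fun m hm ↦ by
    have h := (PadicInt.norm_int_lt_one_iff_dvd (p := 2) m).mp
      ((PadicInt.norm_lt_one_iff_dvd _).mpr (by exact_mod_cast hm))
    exact_mod_cast h
  constructor
  · apply hcast
    have h := congrArg fB e
    rw [map_nsmul, map_add, map_zsmul, map_zsmul, hfB0, hfB1, smul_zero, add_zero, zsmul_eq_mul, mul_one, nsmul_eq_mul,
      Nat.cast_ofNat] at h
    exact ⟨_, h.symm⟩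
  · apply hcast
    have h := congrArg fA e
    rw [map_nsmul, map_add, map_zsmul, map_zsmul, hfA0, hfA1, smul_zero, zero_add, zsmul_eq_mul, mul_one, nsmul_eq_mul,
      Nat.cast_ofNat] at h
    exact ⟨_, h.symm⟩


/-! ## §2 A finite-index `ℤ₂²`-lattice gives a non-degenerate pair -/

/-- ★ **A finite-index subgroup `H ≤ E(K_1·K_v)` with `H ≃+ ℤ₂²` yields a non-degenerate pair**: with `m` the index of `H` in the layer and
`φ : H ≃+ ℤ₂²`, the functionals `x ↦ φ(m·x)_i` and the points `φ⁻¹(e₀), φ⁻¹(e₁)` (values `m ≠ 0` and `0`). [cite: SilvermanAEC2009, VII Prop. 6.3] -/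
theorem exists_nondegeneratePair_of_lattice {H : AddSubgroup (localPoints W E)} (hHle : H ≤ localLayerPointsOfEmb κ ι W 1)
    (hfin : (H.addSubgroupOf (localLayerPointsOfEmb κ ι W 1)).FiniteIndex) (φ : H ≃+ (Fin 2 → ℤ_[2])) :
    ∃ (p₀ p₁ : localLayerPointsOfEmb κ ι W 1 →+ ℤ_[2]) (mA mB : localLayerPointsOfEmb κ ι W 1),
      p₀ mA ≠ 0 ∧ p₁ mA = 0 ∧ p₀ mB = 0 ∧ p₁ mB ≠ 0 := by
  set M := localLayerPointsOfEmb κ ι W 1 with hM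
  set m : ℕ := (H.addSubgroupOf M).index with hm
  have hm0 : m ≠ 0 := hfin.index_ne_zero
  -- `x ↦ m • x` lands in `H`
  have hmem : ∀ x : M, m • (x : localPoints W E) ∈ H := fun x ↦ by
    have h := AddSubgroup.nsmul_index_mem (H.addSubgroupOf M) x
    rw [AddSubgroup.mem_addSubgroupOf, AddSubgroupClass.coe_nsmul] at h
    exact h
  let θ : M →+ H :=
    { toFun := fun x ↦ ⟨m • (x : localPoints W E), hmem x⟩
      map_zero' := by apply Subtype.ext; simp
      map_add' := fun x y ↦ by apply Subtype.ext; simp [smul_add] }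
  have hθ : ∀ x : M, ((θ x : H) : localPoints W E) = m • (x : localPoints W E) := fun _ ↦ rfl
  let q : Fin 2 → (M →+ ℤ_[2]) := fun i ↦ (Pi.evalAddMonoidHom (fun _ : Fin 2 ↦ ℤ_[2]) i).comp (φ.toAddMonoidHom.comp θ)
  have hq : ∀ i x, q i x = φ (θ x) i := fun _ _ ↦ rfl
  -- the two points
  let nA : H := φ.symm (Pi.single 0 1)
  let nB : H := φ.symm (Pi.single 1 1)
  have hnA : (nA : localPoints W E) ∈ M := hHle nA.2
  have hnB : (nB : localPoints W E) ∈ M := hHle nB.2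
  have hθA : θ ⟨nA, hnA⟩ = m • nA := by apply Subtype.ext; rw [hθ, AddSubgroupClass.coe_nsmul]
  have hθB : θ ⟨nB, hnB⟩ = m • nB := by apply Subtype.ext; rw [hθ, AddSubgroupClass.coe_nsmul]
  have hφA : φ (θ ⟨nA, hnA⟩) = m • Pi.single (0 : Fin 2) (1 : ℤ_[2]) := by rw [hθA, map_nsmul, AddEquiv.apply_symm_apply]
  have hφB : φ (θ ⟨nB, hnB⟩) = m • Pi.single (1 : Fin 2) (1 : ℤ_[2]) := by rw [hθB, map_nsmul, AddEquiv.apply_symm_apply]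
  have hmz : (m : ℤ_[2]) ≠ 0 := by exact_mod_cast hm0
  refine ⟨q 0, q 1, ⟨nA, hnA⟩, ⟨nB, hnB⟩, ?_, ?_, ?_, ?_⟩
  · rw [hq, hφA, Pi.smul_apply, Pi.single_eq_same, nsmul_eq_mul, mul_one]; exact hmz
  · rw [hq, hφA, Pi.smul_apply, Pi.single_eq_of_ne (by decide), smul_zero]
  · rw [hq, hφB, Pi.smul_apply, Pi.single_eq_of_ne (by decide), smul_zero]
  · rw [hq, hφB, Pi.smul_apply, Pi.single_eq_same, nsmul_eq_mul, mul_one]; exact hmz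

end Generic

/-! ## §3 Over `ℚ` at `v ∋ 2`: CDF±_H UNCONDITIONALLY -/

section Rat

/-- ★★★ **CDF±_H — the Honda rung of slot 5 — IS A THEOREM.**  For `W/ℚ` globally minimal, non-CM, `GoodSS W 2`, `a₂ ≠ 0`, odd sign, the cyclotomic
`κ` with `γ`, `v ∋ 2`, `g` a local lift of the topological generator, a system `c` with (L)(TR)(Z)(SAT) which is the `c`-part of a HONDA SYSTEM AT TWO:
for every ψ₂-vector `y ∈ E(ℚ_{1,v})` (`g·y = −y`) and every `k` with `y ∉ 2^k·E(ℚ_{1,v})`, some `z ∈ Ker Col♭_c` has `2^{k+1} ∤ z(y)` — the ♭ local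
condition at `ψ₂` is TRANSVERSE to the Kummer line of the twist.  The statement is VERBATIM the body of the line's rung
`OddBlindPackage.FlatBlindLocalTransversalityHondaOffZeroAtTwo` (v2.6.1 :898–925; = `D72BlindGenerator.FlatBlindLocalTransversalityHondaOffZeroAtTwo`).
Proof: Silverman VII.6.3 at layer `1` (tree `silvermanVII63_localLayerPoints_finiteIndex_zpLattice_holds`, rank `2¹` by
`index_localLayerSubgroupOfEmb_eq_pow_of_isTopGenerator`) ⟹ non-degenerate pair (§2) ⟹ (IND₁) (§1) ⟹ (D₁) ⟹ (K₈) ⟹ CDF±_H (p811115 → p811031 → p810939).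
NOT in print: Sprung 2012 §7 is `p` odd, Open Problem 7.22; Kobayashi 2003 Prop. 8.12 ii) is the odd-`p` shape.
[cite: Sprung2012, Thm. 2.2, Lemma 2.3 (p. 1487), Def. 7.9 (p. 1503), Open Problem 7.22 (p. 1505)] [cite: SilvermanAEC2009, VII Prop. 6.3, IV Thm. 6.4 (b)] -/
theorem flatBlindLocalTransversalityHondaOffZeroAtTwo :
    ∀ (W : WeierstrassCurve ℚ) [W.IsElliptic] [W.IsGloballyMinimal],
    ¬ W.HasCM → GoodSS W 2 → W.frobeniusTrace 2 ≠ 0 → W.rootNumber * ZMod.χ₈ (W.conductorNorm ℤ : ZMod 8) = -1 →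
    ∀ (κ : ZpExtension ℚ 2) (γ : Field.absoluteGaloisGroup ℚ),
      κ.IsCyclotomic → κ.IsTopGenerator γ → IsCyclotomicVariable 2 γ →
    ∀ (v : HeightOneSpectrum (𝓞 ℚ)), (2 : 𝓞 ℚ) ∈ v.asIdeal →
    ∀ (g : Field.absoluteGaloisGroup (v.adicCompletion ℚ)) (c : ℕ → localPoints W (v.adicCompletion ℚ)),
      κ.IsTopGenerator (resGalOfEmb (closureEmb (K := ℚ) (v.adicCompletion ℚ)) g) →
      (∀ n, c n ∈ localLayerPointsOfEmb κ (closureEmb (K := ℚ) (v.adicCompletion ℚ)) W n) →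
      (∀ n, 1 ≤ n → localTraceOfEmb κ (closureEmb (K := ℚ) (v.adicCompletion ℚ)) W n (n + 1)
        (c (n + 1)) = W.frobeniusTrace 2 • c n - c (n - 1)) →
      (∀ z₀ : localLayerPointsOfEmb κ (closureEmb (K := ℚ) (v.adicCompletion ℚ)) W 0 →+ ℤ_[2],
        evalOn W (localLayerPointsOfEmb κ (closureEmb (K := ℚ) (v.adicCompletion ℚ)) W 0) z₀ (c 0) = 0 →
          z₀ = 0) →
      (∀ a : ℤ_[2],
        (∃ z₀ : localLayerPointsOfEmb κ (closureEmb (K := ℚ) (v.adicCompletion ℚ)) W 0 →+ ℤ_[2],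
          evalOn W (localLayerPointsOfEmb κ (closureEmb (K := ℚ) (v.adicCompletion ℚ)) W 0) z₀ (c 0) = 2 * a) →
        ∃ y : localLayerPointsOfEmb κ (closureEmb (K := ℚ) (v.adicCompletion ℚ)) W 0 →+ ℤ_[2],
          evalOn W (localLayerPointsOfEmb κ (closureEmb (K := ℚ) (v.adicCompletion ℚ)) W 0) y (c 0) = a) →
      (∃ cneg : localPoints W (v.adicCompletion ℚ),
        Summit.BirchSwinnertonDyer.Rank1Residual.F1Sign2.IsHondaSystemAtTwo κ (closureEmb (K := ℚ) (v.adicCompletion ℚ)) W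
          (W.frobeniusTrace 2) g cneg c) →
      ∀ (y : localPoints W (v.adicCompletion ℚ))
        (hy : y ∈ localLayerPointsOfEmb κ (closureEmb (K := ℚ) (v.adicCompletion ℚ)) W 1), g • y = -y →
        ∀ k : ℕ, (∀ w ∈ localLayerPointsOfEmb κ (closureEmb (K := ℚ) (v.adicCompletion ℚ)) W 1, 2 ^ k • w ≠ y) →
          ∃ z ∈ colemanKer κ (closureEmb (K := ℚ) (v.adicCompletion ℚ)) W (W.frobeniusTrace 2) g c .flat,
            ¬ (2 : ℤ_[2]) ^ (k + 1) ∣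
              z ⟨y, localLayerPointsOfEmb_le_localTowerPointsOfEmb κ (closureEmb (K := ℚ) (v.adicCompletion ℚ)) W 1 hy⟩ := by
  refine flatBlindLocalTransversalityHondaOffZeroAtTwo_of_independent fun W _ _ hss _ κ _ v hv g cneg c hg hH ↦ ?_
  have hv' : ((2 : ℕ) : 𝓞 ℚ) ∈ v.asIdeal := by exact_mod_cast hv
  obtain ⟨H, hHle, hfin, hφ⟩ := silvermanVII63_localLayerPoints_finiteIndex_zpLattice.rat
    silvermanVII63_localLayerPoints_finiteIndex_zpLattice_holds κ hv' (closureEmb (K := ℚ) (v.adicCompletion ℚ)) W 1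
  rw [index_localLayerSubgroupOfEmb_eq_pow_of_isTopGenerator κ (closureEmb (K := ℚ) (v.adicCompletion ℚ)) hg 1, pow_one] at hφ
  obtain ⟨φ⟩ := hφ
  exact independent_of_nondegeneratePair
    (SignedKatoOffTwo.SignedIntersection.noTwoTorsion_localTowerPointsOfEmb_adicCompletion W hss κ v hv _)
    hss.2 hg hH (exists_nondegeneratePair_of_lattice hHle hfin φ)

end Rat

end OddBlindLocal

end Summit.BirchSwinnertonDyer.BirchSwinnertonDyer.Theorems

end
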